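import Summits.KontsevichZagierPeriods.KontsevichZagierPeriods.Theorems.FermatIsogenyDeepWordSectorP02

/-! # `FermatIsogenyDeepWordSectorP03` — part 3/9 of the mechanical ≤400-line split of `DeepWordSector.lean` (sha256 5e8cd5c1c920648a…)
Source: decomp-kz lens-5 g22 DeepWordSector.lean v10 @5e8cd5c1 (the deep Beta-word sector node: bridge S ⟺ BetaWordTower ∧ WordSectorComplete, finite boxes, box ladder, shadow arithmetic, Chudnovsky levels; critic CLEARED g6-2/3/4/11/13/16/19); --supports stmt-KontsevichZagierPeriods-3898.
Split by census-1 g10 `gen/splitlean.py`: scopes re-opened with their `open`/`variable`/`set_option` context; mathematics and declaration order unchanged. -/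

namespace Summit.KontsevichZagierPeriods.FermatIsogeny.DeepTargets
open Literature.NumberTheory.Transcendental MeasureTheory
open Summit.KontsevichZagierPeriods.KontsevichZagierPeriods.Theses.FermatIsogeny (BetaLinearSector BetaProductSector FermatSectorComplete)

/-- **Reduced `k`-letter Beta-word sector**: `BetaWordSector k` restricted to exponent vectors in the fundamental domain
`(0,1]` of the translations `a ↦ a + 1`. At a fixed common denominator `N` this is a statement about the FINITELY many
words with exponents in `{1/N, …, N/N}`. [this node] -/
def BetaWordSectorReduced (k : ℕ) : Prop :=
  ∀ (a b a' b' : Fin k → ℚ) (q : ℝ), (∀ i, 0 < a i ∧ a i ≤ 1) → (∀ i, 0 < b i ∧ b i ≤ 1) →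
    (∀ i, 0 < a' i ∧ a' i ≤ 1) → (∀ i, 0 < b' i ∧ b' i ≤ 1) →
    IsAlgebraic ℚ q → ∀ (r r' : KZ.IntegralRep k), r.domain = {x | ∀ i, x i ∈ Set.Ioo (0:ℝ) 1} →
    Set.EqOn r.integrand (fun x => ∏ i, (x i) ^ ((a i : ℝ) - 1) * (1 - x i) ^ ((b i : ℝ) - 1)) r.domain →
    r'.domain = {x | ∀ i, x i ∈ Set.Ioo (0:ℝ) 1} →
    Set.EqOn r'.integrand (fun x => q * ∏ i, (x i) ^ ((a' i : ℝ) - 1) * (1 - x i) ^ ((b' i : ℝ) - 1)) r'.domain →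
    r.value = r'.value → KZ.Equivalent r r'

/-- The unreduced sector trivially contains the reduced one. [bookkeeping] -/
theorem betaWordSectorReduced_of_betaWordSector {k : ℕ} (h : BetaWordSector k) : BetaWordSectorReduced k :=
  fun a b a' b' q ha hb ha' hb' hq => h a b a' b' q (fun i => (ha i).1) (fun i => (hb i).1) (fun i => (ha' i).1)
    (fun i => (hb' i).1) hq

/-! #### The fundamental domain `(0,1]` of `a ↦ a + 1` on `ℚ_{>0}` -/

/-- The reduced exponent `red a = a − (⌈a⌉ − 1) ∈ (0,1]`. [bookkeeping] -/
def red (a : ℚ) : ℚ := a - ((⌈a⌉ - 1 : ℤ) : ℚ)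

/-- The integer excess `⌈a⌉ − 1` (as a natural number; `a = red a + exc a` for `0 < a`). [bookkeeping] -/
def exc (a : ℚ) : ℕ := (⌈a⌉ - 1).toNat

/-- Auxiliary step `red_pos`: red pos. [bookkeeping] -/
theorem red_pos (a : ℚ) : 0 < red a := by
  have h := Int.ceil_lt_add_one a
  unfold red; push_cast; linarith

/-- Auxiliary step `red_le_one`: red le one. [bookkeeping] -/
theorem red_le_one (a : ℚ) : red a ≤ 1 := by
  have h := Int.le_ceil a
  unfold red; push_cast; linarith

/-- Auxiliary step `red_add_exc`: red add exc. [bookkeeping] -/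
theorem red_add_exc (a : ℚ) (ha : 0 < a) : red a + (exc a : ℚ) = a := by
  have h1 : 1 ≤ ⌈a⌉ := Int.one_le_ceil_iff.mpr ha
  have h2 : ((exc a : ℕ) : ℤ) = ⌈a⌉ - 1 := by
    simp only [exc]; omega
  have h3 : ((exc a : ℕ) : ℚ) = ((⌈a⌉ - 1 : ℤ) : ℚ) := by exact_mod_cast h2
  rw [h3]; unfold red; ring

/-- Rational numbers are real algebraic. [bookkeeping] -/
private theorem isAlgebraic_ratCast (x : ℚ) : IsAlgebraic ℚ (x : ℝ) := by
  have h := isAlgebraic_algebraMap (R := ℚ) (A := ℝ) x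
  rwa [eq_ratCast] at h

/-! #### Beta classes and constants in the formal period ring `P` (stand-alone, Literature-only versions) -/

/-- A representation pinned as `[(0,1), t^{a-1}(1-t)^{b-1}]` exists for `0 < a, b`. (cite KontsevichZagier2001, §1.1) -/
theorem exists_betaRep₁ (a b : ℚ) (ha : 0 < a) (hb : 0 < b) :
    ∃ ρ : KZ.IntegralRep 1, ρ.domain = {x | x 0 ∈ Set.Ioo (0:ℝ) 1} ∧
      Set.EqOn ρ.integrand (fun x => (x 0) ^ ((a : ℝ) - 1) * (1 - x 0) ^ ((b : ℝ) - 1)) ρ.domain := by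
  obtain ⟨ρ, hd, hi⟩ := KZ.exists_cubeBetaRep (fun _ : Fin 1 => a) (fun _ => b) (fun _ => ⟨ha, hb⟩)
  refine ⟨ρ, by rw [cube_one_eq]; exact hd, fun x hx => ?_⟩
  rw [hi hx]
  simp only [Fin.prod_univ_one]

/-- A chosen representation of `β(a,b)` pinned on `(0,1)`. [bookkeeping] -/
noncomputable def bRep (a b : ℚ) (ha : 0 < a) (hb : 0 < b) : KZ.IntegralRep 1 :=
  (exists_betaRep₁ a b ha hb).choose

/-- Auxiliary step `bRep_domain`: b Rep domain. [bookkeeping] -/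
theorem bRep_domain (a b : ℚ) (ha : 0 < a) (hb : 0 < b) :
    (bRep a b ha hb).domain = {x | x 0 ∈ Set.Ioo (0:ℝ) 1} :=
  (exists_betaRep₁ a b ha hb).choose_spec.1

/-- Auxiliary step `bRep_integrand`: b Rep integrand. [bookkeeping] -/
theorem bRep_integrand (a b : ℚ) (ha : 0 < a) (hb : 0 < b) :
    Set.EqOn (bRep a b ha hb).integrand (fun x => (x 0) ^ ((a : ℝ) - 1) * (1 - x 0) ^ ((b : ℝ) - 1))
      (bRep a b ha hb).domain :=
  (exists_betaRep₁ a b ha hb).choose_spec.2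

/-- The class `β(a,b) ∈ P` (junk value `1` off `0 < a, b`). [bookkeeping] -/
noncomputable def bcl (a b : ℚ) : KZ.FormalPeriodRing :=
  if h : 0 < a ∧ 0 < b then KZ.toFormalPeriod (KZ.of (bRep a b h.1 h.2)) else 1

/-- Auxiliary step `bcl_eq`: bcl eq. [bookkeeping] -/
theorem bcl_eq {a b : ℚ} (ha : 0 < a) (hb : 0 < b) :
    bcl a b = KZ.toFormalPeriod (KZ.of (bRep a b ha hb)) := by
  rw [bcl, dif_pos ⟨ha, hb⟩]

/-- Any representation pinned as `β(a,b)` has class `bcl a b` (one integrand-additivity move). [folklore] -/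
theorem toFormalPeriod_eq_bcl {a b : ℚ} (ha : 0 < a) (hb : 0 < b) {ρ : KZ.IntegralRep 1}
    (hd : ρ.domain = {x | x 0 ∈ Set.Ioo (0:ℝ) 1})
    (hi : Set.EqOn ρ.integrand (fun x => (x 0) ^ ((a : ℝ) - 1) * (1 - x 0) ^ ((b : ℝ) - 1)) ρ.domain) :
    KZ.toFormalPeriod (KZ.of ρ) = bcl a b := by
  rw [bcl_eq ha hb]
  apply KZ.toFormalPeriod_eq_iff.mpr
  refine KZ.of_sub_of_mem_relations_of_eqOn ((bRep_domain a b ha hb).trans hd.symm) fun x hx => ?_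
  have hx' : x ∈ (bRep a b ha hb).domain := by rw [bRep_domain, ← hd]; exact hx
  exact (hi hx).trans (bRep_integrand a b ha hb hx').symm

/-- The constant `κ(q) = ⟦[pt, q]⟧ ∈ P` of a real algebraic `q`. (cite KontsevichZagier2001, §1.1) -/
noncomputable def kc (q : ℝ) (hq : IsAlgebraic ℚ q) : KZ.FormalPeriodRing :=
  KZ.toFormalPeriod (KZ.of (KZ.IntegralRep.unit.constMul q hq))

/-- Auxiliary step `kc_congr`: kc congr. [bookkeeping] -/
theorem kc_congr {q q' : ℝ} (hq : IsAlgebraic ℚ q) (hq' : IsAlgebraic ℚ q') (h : q = q') :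
    kc q hq = kc q' hq' := by
  subst h; rfl

/-- Auxiliary step `evalP_kc`: eval P kc. [bookkeeping] -/
@[simp] theorem evalP_kc (q : ℝ) (hq : IsAlgebraic ℚ q) : KZ.evalP (kc q hq) = q := by
  rw [kc, KZ.evalP_toFormalPeriod_of, KZ.IntegralRep.value_constMul, KZ.IntegralRep.value_unit, mul_one]

/-- `⟦q · ρ⟧ = κ(q) ⟦ρ⟧` (`KZ.toFormalPeriod_of_constMul`). (cite KontsevichZagier2001, §1.2 rule (2)) -/
theorem toFormalPeriod_constMul {n : ℕ} (q : ℝ) (hq : IsAlgebraic ℚ q) (ρ : KZ.IntegralRep n) :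
    KZ.toFormalPeriod (KZ.of (ρ.constMul q hq)) = kc q hq * KZ.toFormalPeriod (KZ.of ρ) :=
  KZ.toFormalPeriod_of_constMul q hq ρ

/-- `κ(1) = 1`. [folklore] -/
theorem kc_one : kc 1 isAlgebraic_one = 1 := by
  rw [kc, ← KZ.toFormalPeriod_of_unit]
  congr 1
  exact congrArg KZ.of (KZ.IntegralRep.ext' rfl (by funext x; simp))

/-- `κ(ab) = κ(a)κ(b)`. [folklore] -/
theorem kc_mul (a b : ℝ) (ha : IsAlgebraic ℚ a) (hb : IsAlgebraic ℚ b) :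
    kc (a * b) (ha.mul hb) = kc a ha * kc b hb := by
  rw [kc, kc, kc, KZ.toFormalPeriod_of_mul_of]
  apply KZ.toFormalPeriod_eq_iff.mpr
  refine KZ.of_sub_of_mem_relations_of_eqOn ?_ ?_
  · ext z
    simp [KZ.IntegralRep.prod_domain, KZ.IntegralRep.prodDomain]
  · intro z _
    rw [KZ.IntegralRep.prod_integrand_eq]
    simp [KZ.IntegralRep.prodFun]

/-- `κ(a)κ(a⁻¹) = 1` for `a ≠ 0`. [folklore] -/
theorem kc_mul_kc_inv {a : ℝ} (ha : IsAlgebraic ℚ a) (h0 : a ≠ 0) : kc a ha * kc a⁻¹ ha.inv = 1 := by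
  rw [← kc_mul, ← kc_one]
  exact kc_congr _ _ (mul_inv_cancel₀ h0)

/-- **A cube word representation is the product of its Beta classes** (`KZ.cubeBetaRep_toFormalPeriod_eq_prod`).
(cite KontsevichZagier2001, §4.1) -/
theorem word_class {k : ℕ} (a b : Fin k → ℚ) (hab : ∀ j, 0 < a j ∧ 0 < b j) (r : KZ.IntegralRep k)
    (hr : r.domain = {x | ∀ i, x i ∈ Set.Ioo (0:ℝ) 1})
    (hi : Set.EqOn r.integrand (fun x => ∏ i, (x i) ^ ((a i : ℝ) - 1) * (1 - x i) ^ ((b i : ℝ) - 1)) r.domain) :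
    KZ.toFormalPeriod (KZ.of r) = ∏ j, bcl (a j) (b j) := by
  rw [KZ.cubeBetaRep_toFormalPeriod_eq_prod a b hab r (fun j => bRep (a j) (b j) (hab j).1 (hab j).2) hr hi
    (fun j => bRep_domain _ _ _ _) (fun j => bRep_integrand _ _ _ _)]
  exact Finset.prod_congr rfl fun j _ => (bcl_eq (hab j).1 (hab j).2).symm

/-- The same with an algebraic constant factor: `⟦[(0,1)^k, q·∏]⟧ = κ(q) ∏ⱼ β(aⱼ,bⱼ)`. (cite KontsevichZagier2001, §4.1) -/
theorem word_class_const {k : ℕ} (q : ℝ) (hq : IsAlgebraic ℚ q) (a b : Fin k → ℚ) (hab : ∀ j, 0 < a j ∧ 0 < b j)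
    (r : KZ.IntegralRep k) (hr : r.domain = {x | ∀ i, x i ∈ Set.Ioo (0:ℝ) 1})
    (hi : Set.EqOn r.integrand (fun x => q * ∏ i, (x i) ^ ((a i : ℝ) - 1) * (1 - x i) ^ ((b i : ℝ) - 1)) r.domain) :
    KZ.toFormalPeriod (KZ.of r) = kc q hq * ∏ j, bcl (a j) (b j) := by
  obtain ⟨R, hRd, hRi⟩ := KZ.exists_cubeBetaRep a b hab
  rw [← word_class a b hab R hRd hRi, ← toFormalPeriod_constMul]
  apply KZ.toFormalPeriod_eq_iff.mpr
  refine KZ.of_sub_of_mem_relations_of_eqOn ?_ fun x hx => ?_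
  · show R.domain = r.domain
    rw [hRd, hr]
  · show r.integrand x = q * R.integrand x
    rw [hi hx, hRi (by rw [hRd, ← hr]; exact hx)]

/-! #### Translation and reflection in `P`, iterated down to the fundamental domain -/

/-- `β(a,b+1) = κ(b/(a+b)) β(a,b)` in `P`, from the translation move. (cite AndrewsAskeyRoy1999, §1.1) -/
theorem bcl_succ_right (hT : BetaTranslationMove) (a b : ℚ) (ha : 0 < a) (hb : 0 < b) :
    ∃ (C : ℝ) (hC : IsAlgebraic ℚ C), 0 < C ∧ bcl a (b + 1) = kc C hC * bcl a b := by
  have hb1 : 0 < b + 1 := by linarith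
  have haR : (0:ℝ) < a := by exact_mod_cast ha
  have hbR : (0:ℝ) < b := by exact_mod_cast hb
  have hab : (0:ℝ) < (a:ℝ) + b := by linarith
  have hA : IsAlgebraic ℚ ((a:ℝ) + b) := (isAlgebraic_ratCast a).add (isAlgebraic_ratCast b)
  have hB : IsAlgebraic ℚ (b:ℝ) := isAlgebraic_ratCast b
  have hE : KZ.Equivalent ((bRep a (b + 1) ha hb1).constMul ((a:ℝ) + b) hA) ((bRep a b ha hb).constMul (b:ℝ) hB) := by
    refine hT a b ha hb _ _ (bRep_domain _ _ _ _) (fun x hx => ?_) (bRep_domain _ _ _ _) (fun x hx => ?_)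
    · show ((a:ℝ) + b) * (bRep a (b + 1) ha hb1).integrand x = _
      rw [bRep_integrand a (b + 1) ha hb1 hx]
      simp only [Rat.cast_add, Rat.cast_one, add_sub_cancel_right]
    · show (b:ℝ) * (bRep a b ha hb).integrand x = _
      rw [bRep_integrand a b ha hb hx]
  have h := hE.toFormalPeriod_eq
  rw [toFormalPeriod_constMul, toFormalPeriod_constMul, ← bcl_eq, ← bcl_eq] at h
  refine ⟨((a:ℝ) + b)⁻¹ * b, hA.inv.mul hB, by positivity, ?_⟩
  calc bcl a (b + 1) = kc ((a:ℝ) + b)⁻¹ hA.inv * (kc ((a:ℝ) + b) hA * bcl a (b + 1)) := by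
        rw [← mul_assoc, mul_comm (kc _ hA.inv), kc_mul_kc_inv hA hab.ne', one_mul]
    _ = kc ((a:ℝ) + b)⁻¹ hA.inv * (kc (b:ℝ) hB * bcl a b) := by rw [h]
    _ = kc (((a:ℝ) + b)⁻¹ * b) (hA.inv.mul hB) * bcl a b := by rw [← mul_assoc, ← kc_mul]

/-- `β(a,b) = β(b,a)` in `P`, from the reflection move. (cite KontsevichZagier2001, §1.2 rule (2)) -/
theorem bcl_symm (hR : BetaReflectionMove) (a b : ℚ) (ha : 0 < a) (hb : 0 < b) : bcl a b = bcl b a := by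
  rw [bcl_eq ha hb, bcl_eq hb ha]
  exact (hR ((a:ℝ) - 1) ((b:ℝ) - 1) (bRep a b ha hb) (bRep b a hb ha) (bRep_domain _ _ _ _)
    (bRep_integrand _ _ _ _) (bRep_domain _ _ _ _) (bRep_integrand _ _ _ _)).toFormalPeriod_eq

/-- `β(a,b+n) = κ(C) β(a,b)` with `C > 0` rational (iterated translation). (cite AndrewsAskeyRoy1999, §1.1) -/
theorem bcl_add_nat_right (hT : BetaTranslationMove) (a b : ℚ) (ha : 0 < a) (hb : 0 < b) (n : ℕ) :
    ∃ (C : ℝ) (hC : IsAlgebraic ℚ C), 0 < C ∧ bcl a (b + n) = kc C hC * bcl a b := by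
  induction n with
  | zero => exact ⟨1, isAlgebraic_one, one_pos, by rw [Nat.cast_zero, add_zero, kc_one, one_mul]⟩
  | succ n ih =>
    obtain ⟨C, hC, hC0, hCe⟩ := ih
    obtain ⟨D, hD, hD0, hDe⟩ := bcl_succ_right hT a (b + n) ha (by positivity)
    refine ⟨D * C, hD.mul hC, mul_pos hD0 hC0, ?_⟩
    rw [Nat.cast_succ, ← add_assoc, hDe, hCe, ← mul_assoc, ← kc_mul]

/-- **Reduction of one letter to the fundamental domain**: `β(a,b) = κ(C)·β(red a, red b)`, `C > 0` algebraic
(in fact rational). [this node] -/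
theorem bcl_reduce (hR : BetaReflectionMove) (hT : BetaTranslationMove) (a b : ℚ) (ha : 0 < a) (hb : 0 < b) :
    ∃ (C : ℝ) (hC : IsAlgebraic ℚ C), 0 < C ∧ bcl a b = kc C hC * bcl (red a) (red b) := by
  obtain ⟨C₁, hC₁, h1, e1⟩ := bcl_add_nat_right hT b (red a) hb (red_pos a) (exc a)
  obtain ⟨C₂, hC₂, h2, e2⟩ := bcl_add_nat_right hT (red a) (red b) (red_pos a) (red_pos b) (exc b)
  rw [red_add_exc a ha] at e1
  rw [red_add_exc b hb] at e2
  refine ⟨C₁ * C₂, hC₁.mul hC₂, mul_pos h1 h2, ?_⟩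
  rw [bcl_symm hR a b ha hb, e1, bcl_symm hR b (red a) hb (red_pos a), e2, ← mul_assoc, ← kc_mul]

/-- **Reduction of a word**: `∏ⱼ β(aⱼ,bⱼ) = κ(C)·∏ⱼ β(red aⱼ, red bⱼ)` with `C > 0` algebraic. [this node] -/
theorem word_reduce (hR : BetaReflectionMove) (hT : BetaTranslationMove) :
    ∀ {k : ℕ} (a b : Fin k → ℚ), (∀ j, 0 < a j ∧ 0 < b j) →
      ∃ (C : ℝ) (hC : IsAlgebraic ℚ C), 0 < C ∧
        ∏ j, bcl (a j) (b j) = kc C hC * ∏ j, bcl (red (a j)) (red (b j))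
  | 0, a, b, _ => ⟨1, isAlgebraic_one, one_pos, by simp [kc_one]⟩
  | k + 1, a, b, hab => by
    obtain ⟨C, hC, hC0, e⟩ := word_reduce hR hT (fun j : Fin k => a j.succ) (fun j => b j.succ) (fun j => hab j.succ)
    obtain ⟨D, hD, hD0, e'⟩ := bcl_reduce hR hT (a 0) (b 0) (hab 0).1 (hab 0).2
    refine ⟨D * C, hD.mul hC, mul_pos hD0 hC0, ?_⟩
    rw [Fin.prod_univ_succ, Fin.prod_univ_succ, e', e, kc_mul D C hD hC]
    ring

/-! #### The reduction theorem -/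

/-- **`BetaWordSectorReduced k → BetaWordSector k`** (given the reflection and translation moves): reduce all `4k`
exponents to `(0,1]` letter by letter in `P` (`word_reduce`), transport the value hypothesis through `KZ.evalP`, apply the
reduced sector to the reduced cube representations (the second one rescaled by the quotient of the two reduction
constants), and reassemble in `P`. [this node] -/
theorem betaWordSector_of_reduced (hR : BetaReflectionMove) (hT : BetaTranslationMove) {k : ℕ}
    (h : BetaWordSectorReduced k) : BetaWordSector k := by
  intro a b a' b' q ha hb ha' hb' hq r r' hr hi hr' hi' hv
  have hab : ∀ j, 0 < a j ∧ 0 < b j := fun j => ⟨ha j, hb j⟩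
  have hab' : ∀ j, 0 < a' j ∧ 0 < b' j := fun j => ⟨ha' j, hb' j⟩
  have hxy : ∀ j, 0 < red (a j) ∧ 0 < red (b j) := fun j => ⟨red_pos _, red_pos _⟩
  have hxy' : ∀ j, 0 < red (a' j) ∧ 0 < red (b' j) := fun j => ⟨red_pos _, red_pos _⟩
  obtain ⟨C, hC, hC0, eC⟩ := word_reduce hR hT a b hab
  obtain ⟨C', hC', hC'0, eC'⟩ := word_reduce hR hT a' b' hab'
  obtain ⟨R, hRd, hRi⟩ := KZ.exists_cubeBetaRep (fun j => red (a j)) (fun j => red (b j)) hxy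
  obtain ⟨R', hR'd, hR'i⟩ := KZ.exists_cubeBetaRep (fun j => red (a' j)) (fun j => red (b' j)) hxy'
  have hq' : IsAlgebraic ℚ (q * C' * C⁻¹) := (hq.mul hC').mul hC.inv
  -- classes in `P`
  have er : KZ.toFormalPeriod (KZ.of r) = kc C hC * ∏ j, bcl (red (a j)) (red (b j)) := by
    rw [word_class a b hab r hr hi, eC]
  have er' : KZ.toFormalPeriod (KZ.of r') = kc q hq * (kc C' hC' * ∏ j, bcl (red (a' j)) (red (b' j))) := by
    rw [word_class_const q hq a' b' hab' r' hr' hi', eC']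
  have eR : KZ.toFormalPeriod (KZ.of R) = ∏ j, bcl (red (a j)) (red (b j)) := word_class _ _ hxy R hRd hRi
  have eR' : KZ.toFormalPeriod (KZ.of R') = ∏ j, bcl (red (a' j)) (red (b' j)) := word_class _ _ hxy' R' hR'd hR'i
  have hR''i : Set.EqOn (R'.constMul (q * C' * C⁻¹) hq').integrand
      (fun x => (q * C' * C⁻¹) * ∏ i, (x i) ^ ((red (a' i) : ℝ) - 1) * (1 - x i) ^ ((red (b' i) : ℝ) - 1))
      (R'.constMul (q * C' * C⁻¹) hq').domain := fun z hz => by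
    show (q * C' * C⁻¹) * R'.integrand z = _
    rw [hR'i hz]
  have eR'' : KZ.toFormalPeriod (KZ.of (R'.constMul (q * C' * C⁻¹) hq')) =
      kc (q * C' * C⁻¹) hq' * ∏ j, bcl (red (a' j)) (red (b' j)) :=
    word_class_const _ hq' _ _ hxy' _ hR'd hR''i
  -- values through `evalP`
  have vr : r.value = C * R.value := by
    have h1 := congrArg KZ.evalP er
    rw [← eR, map_mul, evalP_kc, KZ.evalP_toFormalPeriod_of, KZ.evalP_toFormalPeriod_of] at h1
    exact h1
  have vr' : r'.value = q * (C' * R'.value) := by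
    have h1 := congrArg KZ.evalP er'
    rw [← eR', map_mul, map_mul, evalP_kc, evalP_kc, KZ.evalP_toFormalPeriod_of, KZ.evalP_toFormalPeriod_of] at h1
    exact h1
  have hvR : R.value = (R'.constMul (q * C' * C⁻¹) hq').value := by
    rw [KZ.IntegralRep.value_constMul]
    have hC1 : C ≠ 0 := hC0.ne'
    apply mul_left_cancel₀ hC1
    rw [← vr, hv, vr']
    field_simp
  -- the reduced sector
  have H : KZ.Equivalent R (R'.constMul (q * C' * C⁻¹) hq') :=
    h _ _ _ _ (q * C' * C⁻¹) (fun i => ⟨red_pos _, red_le_one _⟩) (fun i => ⟨red_pos _, red_le_one _⟩)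
      (fun i => ⟨red_pos _, red_le_one _⟩) (fun i => ⟨red_pos _, red_le_one _⟩) hq' R _ hRd hRi hR'd hR''i hvR
  have eRR := H.toFormalPeriod_eq
  rw [eR, eR''] at eRR
  have hC1 : C ≠ 0 := hC0.ne'
  have hcc : C * (q * C' * C⁻¹) = q * C' := by
    rw [mul_comm C (q * C' * C⁻¹), mul_assoc (q * C') C⁻¹ C, inv_mul_cancel₀ hC1, mul_one]
  have e : KZ.toFormalPeriod (KZ.of r) = KZ.toFormalPeriod (KZ.of r') := by
    rw [er, er', eRR, ← mul_assoc (kc C hC), ← kc_mul C (q * C' * C⁻¹) hC hq', ← mul_assoc (kc q hq),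
      ← kc_mul q C' hq hC', kc_congr (hC.mul hq') (hq.mul hC') hcc]
  show KZ.of r - KZ.of r' ∈ KZ.relations
  exact KZ.toFormalPeriod_eq_iff.mp e

/-- **`BetaWordSector k ↔ BetaWordSectorReduced k`** given the two elementary Beta moves. [this node] -/
theorem betaWordSector_iff_reduced (hR : BetaReflectionMove) (hT : BetaTranslationMove) (k : ℕ) :
    BetaWordSector k ↔ BetaWordSectorReduced k :=
  ⟨betaWordSectorReduced_of_betaWordSector, betaWordSector_of_reduced hR hT⟩

/-! ### The finite boxes: at a common denominator `N` the reduced sector is a statement about `N^{4k}` exponent patterns -/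

/-- Exponents of level `N` indexed by `Fin N`: `lvl N u i = (uᵢ + 1)/N ∈ {1/N, …, N/N}`. [bookkeeping] -/
def lvl {k : ℕ} (N : ℕ) (u : Fin k → Fin N) : Fin k → ℚ := fun i => ((u i : ℕ) + 1 : ℚ) / N

/-- Auxiliary step `lvl_bounds`: lvl bounds. [bookkeeping] -/
theorem lvl_bounds {k N : ℕ} (hN : 0 < N) (u : Fin k → Fin N) : ∀ i, 0 < lvl N u i ∧ lvl N u i ≤ 1 := by
  intro i
  have hN' : (0:ℚ) < N := by exact_mod_cast hN
  have hu : ((u i : ℕ) : ℚ) + 1 ≤ N := by exact_mod_cast (u i).isLt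
  refine ⟨by unfold lvl; positivity, ?_⟩
  unfold lvl
  rw [div_le_one hN']
  exact hu

/-- **The `(k, N)` box of Conjecture 1**: `BetaWordSector k` for exponent vectors of level `N` in the fundamental domain,
i.e. for the finitely many (`N^{4k}`) exponent patterns `(u, v, u', v') : (Fin k → Fin N)⁴`. [this node] -/
def BetaWordSectorLevel (k N : ℕ) : Prop :=
  ∀ (u v u' v' : Fin k → Fin N) (q : ℝ), IsAlgebraic ℚ q → ∀ (r r' : KZ.IntegralRep k),
    r.domain = {x | ∀ i, x i ∈ Set.Ioo (0:ℝ) 1} →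
    Set.EqOn r.integrand (fun x => ∏ i, (x i) ^ ((lvl N u i : ℝ) - 1) * (1 - x i) ^ ((lvl N v i : ℝ) - 1)) r.domain →
    r'.domain = {x | ∀ i, x i ∈ Set.Ioo (0:ℝ) 1} →
    Set.EqOn r'.integrand (fun x => q * ∏ i, (x i) ^ ((lvl N u' i : ℝ) - 1) * (1 - x i) ^ ((lvl N v' i : ℝ) - 1))
      r'.domain →
    r.value = r'.value → KZ.Equivalent r r'

/-- A rational in `(0,1]` whose denominator divides `N > 0` is `(u+1)/N` for some `u : Fin N`. [bookkeeping] -/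
theorem exists_fin_of_den_dvd (a : ℚ) (ha0 : 0 < a) (ha1 : a ≤ 1) {N : ℕ} (hN : 0 < N) (hd : a.den ∣ N) :
    ∃ u : Fin N, a = ((u : ℕ) + 1 : ℚ) / N := by
  obtain ⟨m, hm⟩ := hd
  have hden : 0 < a.den := a.den_pos
  have hm0 : 0 < m := by
    rcases Nat.eq_zero_or_pos m with h | h
    · rw [h, mul_zero] at hm; omega
    · exact h
  have hnum : 0 < a.num := Rat.num_pos.mpr ha0
  have hN' : (0:ℚ) < N := by exact_mod_cast hN
  -- `a = (a.num * m) / N`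
  have ha : a = ((a.num * m : ℤ) : ℚ) / N := by
    rw [hm]; push_cast
    rw [mul_div_mul_right _ _ (by exact_mod_cast hm0.ne' : (m:ℚ) ≠ 0)]
    exact (Rat.num_div_den a).symm
  have hn0 : 0 < a.num * m := mul_pos hnum (by exact_mod_cast hm0)
  have hnN : a.num * m ≤ N := by
    have h1 : ((a.num * m : ℤ) : ℚ) / N ≤ 1 := ha ▸ ha1
    rw [div_le_one hN'] at h1
    exact_mod_cast h1
  have h2 : (((a.num * m - 1).toNat : ℕ) : ℤ) = a.num * m - 1 := Int.toNat_of_nonneg (by omega)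
  have h3 : (((a.num * m - 1).toNat : ℕ) : ℚ) = ((a.num * m - 1 : ℤ) : ℚ) := by exact_mod_cast h2
  refine ⟨⟨(a.num * m - 1).toNat, by omega⟩, ?_⟩
  rw [h3]
  conv_lhs => rw [ha]
  push_cast; ring

end Summit.KontsevichZagierPeriods.FermatIsogeny.DeepTargets
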